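import Summits.QuantumFields.BalabanUV.Beta.GAN24.LayerLetterFaces
import Summits.QuantumFields.BalabanUV.Beta.GAN24.GaugeReadLayerForm

/-!
# `BalabanUV.Beta.GAN24.LayerLetterGaugeRead` — binder row G-an2-4 ∕ (CONV-C), W-slot CT-W, route «WC-TL» ∕ (Q-R) «QR-LL», row (LAY), programme
# «(LAY-LIT) THE LITERAL's LETTER PROFILE ROWS `hS ∧ hω` OF THE (Q-R) END», PART 4:
# **THE GAUGE-READ PIECE (γ) SUMMED OVER THE LABELS OF A SUPER-BLOCK IS A FACE LETTER AT THE SLOT, IN FACE-SUM FORM** — the response superposition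
# `𝒢[A](ĝ_T)` paired with the indicator gradient of the fine union is `BiLoc` at `p` with constant `C·FW_U^δ(q)` (G-an2-4 formalisation swarm → CRUX TEAM (2), leaf prover
# `b2b-balaban-gan24-formalise-leaf-03`, gen 61; INTENT 4, journal `CLAIMS.log`; names PROVISIONAL)

NOT IN PRINT; OUR BOOKKEEPING ([folklore] one triangle inequality over leaf-06 g44's `GaugeReadLayerForm.sum_read_gaugeWt_eq_layers` (the CANCELLED LAYER FORM of the read)
and `GaugeReadLabelSums.sum_gaugeSup` (the label sums, an1's `wsum ∕ cwsum` bookkeeping) BY NAME, then `biLoc_wsum ∕ biLoc_cwsum` exactly as in leaf-06's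
`biLoc_sup_of_weight`; generic `d`, GENERIC `A ∕ S ∕ M ∕ T` — no object of an2's typed system; 0 `def`, 0 cited facts, 0 `def … : Prop`, 0 sorry).  HONEST FRAMING (cell
contract, verbatim): «discharging `BetaPertH` makes Bałaban's UV stability UNCONDITIONAL — a real constructive-QFT result; it is NOT the continuum limit and NOT the Clay
problem.»  HONEST DEPENDENCY (verbatim): «continuum YM on T⁴ ⇐ BetaPertH ∧ nine spine estimates (0/9 proved); BetaPertH ⇐ (D1) ∧ (D4) ∧ CAP+tail; G-an2-4 gates asym,
D1 and NE2/3/4.»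

## What
The (γ) piece of the explicit first-order data `Ψ_j(y; ν, y′)` of `WardResidualSUnrolled.exists_kernelLaws_unrolled` is (minus a scalar times) an1's response superposition
`𝒢[A](ĝ_y) = Σ_κ wsum (u ↦ Σ'_{x₂} Σ_{κ₂} A u x₂ (inl κ)(inl κ₂)·ĝ_y κ₂ x₂) (S κ) + Σ_ρ cwsum N (w ↦ Σ'_{x₂} Σ_{κ₂} A (N•w) x₂ (inr ρ)(inl κ₂)·ĝ_y κ₂ x₂) (M ρ)`,
`A = G_j ∘ dM G_j Lc S_j M1_j ν y′`, `ĝ_y = gaugeWt Lc y = ∇𝟙_{B(y)}`.  leaf-06 g44 typed: the label sum is `𝒢[A](ĝ_T)` with the UNION weight `ĝ_T = ∇𝟙_U` (`sum_gaugeSup`), its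
class is the single-label class for every `T` (`biLoc_gaugeSup_sum` — constant from `sup |ĝ_T| ≤ 1`, NO face information), and the layer envelope in DISTANCE-WITNESS form
(`biLoc_gaugeSup_sum_of_support`, `× e^{−(δ∕2)D}`).  The END's `hS ∧ hω` want the FACE-SUM form; THIS FILE supplies it:
* §1 **`abs_read_sum_gaugeWt_le_faceW`** — for `A` bi-localised at `(p, q)` (rate `δ`) and `1 ≤ N`: `|Σ'_{x₂} Σ_{κ₂} A u x₂ a (inl κ₂)·ĝ_T κ₂ x₂| ≤ C·e^{−δ‖u−p‖₁}·FW_U^δ(q)`, `U` the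
  fine union of `T` — by `sum_read_gaugeWt_eq_layers` the read is `A u ·` on the ENTERING layer minus `A u ·` on the EXITING layer, nothing in the bulk; one triangle
  inequality.  (The weight bound the END consumes: the read weight of the slot `u` is the kernel's own decay from `p` TIMES the face weight at `q`.)
* §2 **`biLoc_gaugeSup_sum_faceW(_of_faceW)`** — `𝒢[A](ĝ_T)` is `BiLoc` at `(p, p)`, rate `δ∕2`, constant `(d+1)·C·(Cs + CM)·Zl(δ∕2)·FW_U^δ(q)` (`LocStencil S Cs δ`,
  `VertexFamily M N CM δ`; `biLoc_wsum ∕ biLoc_cwsum` as in leaf-06's `biLoc_sup_of_weight`, with §1 in place of `abs_read_le`); abstract-weight form: any `W ≥ FW_U^δ(q)`.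
* §3 **`biLoc_sum_gaugeSup_faceW(_of_faceW)`** — THE LITERAL SHAPE: the label-by-label sum `Σ_{y∈T} 𝒢[A](ĝ_y)` (the left-hand side of `sum_gaugeSup`) has the same bound.
= the (γ) third of PART 5's `Ψ_T` (there `A := G ∘ dM G N S M ν y′`, `p = q = N•y′`, and the scalar `−(scale)⁻¹`).  DISCHARGES NO ROW: (LAY)'s literal rows, (LT), K-LL-4, the
(S) row ((M0)_γ ∕ (W-γ) are leaf-06's ∕ p2's CHARGE statements, untouched here), the END and (Q-R) are NOT here; 0 estimate of Bałaban's; NOTHING of (Q-R) ∕ (LT) ∕ (Q-L) ∕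
(C) ∕ (S) ∕ «T2Shape» ∕ «T2Drift» ∕ (hW, hWall) discharged; NEVER «G-an2-4 closed» as (CONV-C); NOT D1, NOT `BetaPertH`, NOT continuum, NOT Clay.  2026-08-22.
-/

noncomputable section

namespace Summit.QuantumFields.BalabanUV.Beta.GAN24.LayerLetterGaugeRead

open Finset
open scoped BigOperators
open Literature.MathematicalPhysics.QuantumFieldTheory
open Literature.MathematicalPhysics.QuantumFieldTheory.Balaban1983to89
open Literature.MathematicalPhysics.QuantumFieldTheory.Balaban1983to89.Beta
open Literature.MathematicalPhysics.QuantumFieldTheory.Balaban1983to89.B12Sec2to5 (l1 l1_nonneg)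
open B6BondElimination (unitVec)
open ExpKernelCalculus (MKer Site BiLoc Decays VertexFamily comp Zl Zl_nonneg)
open OneStepResolventKernel (Fib LocStencil wsum biLoc_wsum)
open InterLevelTransport (cwsum biLoc_cwsum)
open KernelWard (biLoc_add biLoc_finset_sum)
open StepJetData (biLoc_weaken)
open AffineAveraging (box toSite)
open Summit.QuantumFields.BalabanUV.Beta.KernelWardRelative (gaugeWt)
open Summit.QuantumFields.BalabanUV.Beta.GAN24.LayerLetterFaces (faceW_nonneg)
open Summit.QuantumFields.BalabanUV.Beta.GAN24.GaugeReadLayerForm (sum_read_gaugeWt_eq_layers)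
open Summit.QuantumFields.BalabanUV.Beta.GAN24.GaugeReadLabelSums (sum_gaugeSup)

variable {d N : ℕ}

/-! ## §1 The read weight against the union's indicator gradient: kernel decay from `p` times the face weight at `q` -/

/-- [folklore] **THE READ WEIGHT IN FACE-SUM FORM.**  For `A` bi-localised at `(p, q)` (`|A u x₂ a b| ≤ C·e^{−δ(‖u−p‖₁+‖x₂−q‖₁)}`), `1 ≤ N`, every finset `T` of labels
with fine union `U = T.biUnion (y ↦ (box).image (v ↦ N•y + toSite v))`, every `u`, `a`:
`|Σ'_{x₂} Σ_{κ₂} A u x₂ a (inl κ₂)·(Σ_{y∈T} gaugeWt N y κ₂ x₂)| ≤ C·e^{−δ‖u−p‖₁}·FW_U^δ(q)` — leaf-06's cancelled layer form `sum_read_gaugeWt_eq_layers` (entering layer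
minus exiting layer, nothing in the bulk) and one triangle inequality. -/
theorem abs_read_sum_gaugeWt_le_faceW {A : MKer (d + 1) (Fib d)} {p q : Site (d + 1)} {C δ : ℝ} (hA : BiLoc A p q C δ) (hN : 1 ≤ N)
    (T : Finset (Site (d + 1))) (u : Site (d + 1)) (a : Fib d) :
    |∑' x₂, ∑ κ₂, A u x₂ a (Sum.inl κ₂) * ∑ y ∈ T, gaugeWt N y κ₂ x₂|
      ≤ C * Real.exp (-δ * l1 (u - p))
        * ∑ κ : Fin (d + 1),
          (∑ w' ∈ (T.biUnion (fun y => (box (d + 1) N).image (fun v => (N : ℤ) • y + toSite v))).image (fun v => v - unitVec κ)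
                \ T.biUnion (fun y => (box (d + 1) N).image (fun v => (N : ℤ) • y + toSite v)), Real.exp (-δ * l1 (w' - q))
            + ∑ w' ∈ T.biUnion (fun y => (box (d + 1) N).image (fun v => (N : ℤ) • y + toSite v))
                \ (T.biUnion (fun y => (box (d + 1) N).image (fun v => (N : ℤ) • y + toSite v))).image (fun v => v - unitVec κ),
                  Real.exp (-δ * l1 (w' - q))) := by
  rw [sum_read_gaugeWt_eq_layers hN (fun κ₂ x₂ => A u x₂ a (Sum.inl κ₂)) T]
  have hent : ∀ (κ : Fin (d + 1)) (w' : Site (d + 1)),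
      |A u w' a (Sum.inl κ)| ≤ C * Real.exp (-δ * l1 (u - p)) * Real.exp (-δ * l1 (w' - q)) := by
    intro κ w'
    have h := hA u w' a (Sum.inl κ)
    rwa [mul_add, Real.exp_add, ← mul_assoc] at h
  refine (Finset.abs_sum_le_sum_abs _ _).trans ?_
  rw [Finset.mul_sum]
  refine Finset.sum_le_sum fun κ _ => ?_
  refine (abs_sub _ _).trans ?_
  rw [mul_add, Finset.mul_sum, Finset.mul_sum]
  exact add_le_add
    ((Finset.abs_sum_le_sum_abs _ _).trans (Finset.sum_le_sum fun w' _ => hent κ w'))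
    ((Finset.abs_sum_le_sum_abs _ _).trans (Finset.sum_le_sum fun w' _ => hent κ w'))

/-! ## §2 The response superposition with the union weight, face-sum form -/

/-- [folklore] **`𝒢[A](ĝ_T)` IS A FACE LETTER (face-sum domination form).**  For `A` bi-localised at `(p, q)` (`0 < δ`), `1 ≤ N`, `LocStencil S Cs δ`, `VertexFamily M N CM δ`,
every finset `T` of labels (fine union `U`) and any `W` with `FW_U^δ(q) ≤ W`: an1's response superposition paired with the union weight `ĝ_T = Σ_{y∈T} gaugeWt N y`,
`Σ_κ wsum (u ↦ Σ'Σ A u x₂ (inl κ)(inl κ₂)·ĝ_T κ₂ x₂) (S κ) + Σ_ρ cwsum N (w ↦ Σ'Σ A (N•w) x₂ (inr ρ)(inl κ₂)·ĝ_T κ₂ x₂) (M ρ)`, is `BiLoc` at `(p, p)`, rate `δ∕2`, constant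
`(d+1)·C·(Cs + CM)·Zl(δ∕2)·W` — leaf-06's `biLoc_sup_of_weight` with §1 in place of the sup-weight bound: the FACE WEIGHT at `q` replaces an1's `(d+1)·Zl δ`. -/
theorem biLoc_gaugeSup_sum_faceW_of_faceW [NeZero N] {A : MKer (d + 1) (Fib d)} {p q : Site (d + 1)} {C δ : ℝ} (hA : BiLoc A p q C δ) (hδ : 0 < δ)
    (hN : 1 ≤ N) {S : Fin (d + 1) → Site (d + 1) → MKer (d + 1) (Fib d)} {Cs : ℝ} (hS : LocStencil S Cs δ)
    {M : Fin (d + 1) → Site (d + 1) → MKer (d + 1) (Fib d)} {CM : ℝ} (hM : VertexFamily M N CM δ) (T : Finset (Site (d + 1))) {W : ℝ}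
    (hW : (∑ κ : Fin (d + 1),
          (∑ w' ∈ (T.biUnion (fun y => (box (d + 1) N).image (fun v => (N : ℤ) • y + toSite v))).image (fun v => v - unitVec κ)
                \ T.biUnion (fun y => (box (d + 1) N).image (fun v => (N : ℤ) • y + toSite v)), Real.exp (-δ * l1 (w' - q))
            + ∑ w' ∈ T.biUnion (fun y => (box (d + 1) N).image (fun v => (N : ℤ) • y + toSite v))
                \ (T.biUnion (fun y => (box (d + 1) N).image (fun v => (N : ℤ) • y + toSite v))).image (fun v => v - unitVec κ),
                  Real.exp (-δ * l1 (w' - q)))) ≤ W) :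
    BiLoc (∑ κ, wsum (fun u => ∑' x₂, ∑ κ₂, A u x₂ (Sum.inl κ) (Sum.inl κ₂) * ∑ y ∈ T, gaugeWt N y κ₂ x₂) (S κ)
        + ∑ ρ, cwsum N (fun w => ∑' x₂, ∑ κ₂, A ((N : ℤ) • w) x₂ (Sum.inr ρ) (Sum.inl κ₂) * ∑ y ∈ T, gaugeWt N y κ₂ x₂) (M ρ)) p p
      (((d : ℝ) + 1) * C * (Cs + CM) * Zl (d + 1) (δ / 2) * W) (δ / 2) := by
  have hC : 0 ≤ C := hA.nonneg (Sum.inl 0)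
  have hW0 : 0 ≤ W := (faceW_nonneg _ δ q).trans hW
  have hCW : 0 ≤ C * W := mul_nonneg hC hW0
  -- the weights: kernel decay from `p` times the face weight (§1), the face weight dominated by `W`
  have hwS : ∀ (κ : Fin (d + 1)) (u : Site (d + 1)),
      |∑' x₂, ∑ κ₂, A u x₂ (Sum.inl κ) (Sum.inl κ₂) * ∑ y ∈ T, gaugeWt N y κ₂ x₂| ≤ C * W * Real.exp (-δ * l1 (u - p)) := by
    intro κ u
    refine (abs_read_sum_gaugeWt_le_faceW hA hN T u (Sum.inl κ)).trans ?_
    rw [mul_assoc, mul_assoc]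
    refine mul_le_mul_of_nonneg_left ?_ hC
    rw [mul_comm]
    exact mul_le_mul_of_nonneg_right hW (Real.exp_pos _).le
  have hwM : ∀ (ρ : Fin (d + 1)) (w : Site (d + 1)),
      |∑' x₂, ∑ κ₂, A ((N : ℤ) • w) x₂ (Sum.inr ρ) (Sum.inl κ₂) * ∑ y ∈ T, gaugeWt N y κ₂ x₂| ≤ C * W * Real.exp (-δ * l1 ((N : ℤ) • w - p)) := by
    intro ρ w
    refine (abs_read_sum_gaugeWt_le_faceW hA hN T ((N : ℤ) • w) (Sum.inr ρ)).trans ?_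
    rw [mul_assoc, mul_assoc]
    refine mul_le_mul_of_nonneg_left ?_ hC
    rw [mul_comm]
    exact mul_le_mul_of_nonneg_right hW (Real.exp_pos _).le
  have h1 : ∀ κ : Fin (d + 1), BiLoc (wsum (fun u => ∑' x₂, ∑ κ₂, A u x₂ (Sum.inl κ) (Sum.inl κ₂) * ∑ y ∈ T, gaugeWt N y κ₂ x₂) (S κ)) p p
      (C * W * Cs * Zl (d + 1) (δ / 2)) (δ / 2) := fun κ =>
    biLoc_wsum (hwS κ) (fun u => hS κ u) hδ hCW
  have h2 : ∀ ρ : Fin (d + 1), BiLoc (cwsum N (fun w => ∑' x₂, ∑ κ₂, A ((N : ℤ) • w) x₂ (Sum.inr ρ) (Sum.inl κ₂) * ∑ y ∈ T, gaugeWt N y κ₂ x₂) (M ρ)) p p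
      (C * W * CM * Zl (d + 1) (δ / 2)) (δ / 2) := fun ρ =>
    biLoc_cwsum (hwM ρ) (fun w => hM ρ w) hδ hCW
  have hs1 := biLoc_finset_sum (Finset.univ : Finset (Fin (d + 1))) (fun κ _ => h1 κ)
  have hs2 := biLoc_finset_sum (Finset.univ : Finset (Fin (d + 1))) (fun ρ _ => h2 ρ)
  rw [Finset.sum_const, Finset.card_univ, Fintype.card_fin, nsmul_eq_mul] at hs1 hs2
  refine biLoc_weaken (biLoc_add hs1 hs2) (le_of_eq ?_) le_rfl
  push_cast
  ring

/-- [folklore] **`𝒢[A](ĝ_T)` IS A FACE LETTER, FACE-SUM FORM** (`W := FW_U^δ(q)`): constant `(d+1)·C·(Cs + CM)·Zl(δ∕2)·FW_U^δ(q)`, rate `δ∕2`. -/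
theorem biLoc_gaugeSup_sum_faceW [NeZero N] {A : MKer (d + 1) (Fib d)} {p q : Site (d + 1)} {C δ : ℝ} (hA : BiLoc A p q C δ) (hδ : 0 < δ)
    (hN : 1 ≤ N) {S : Fin (d + 1) → Site (d + 1) → MKer (d + 1) (Fib d)} {Cs : ℝ} (hS : LocStencil S Cs δ)
    {M : Fin (d + 1) → Site (d + 1) → MKer (d + 1) (Fib d)} {CM : ℝ} (hM : VertexFamily M N CM δ) (T : Finset (Site (d + 1))) :
    BiLoc (∑ κ, wsum (fun u => ∑' x₂, ∑ κ₂, A u x₂ (Sum.inl κ) (Sum.inl κ₂) * ∑ y ∈ T, gaugeWt N y κ₂ x₂) (S κ)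
        + ∑ ρ, cwsum N (fun w => ∑' x₂, ∑ κ₂, A ((N : ℤ) • w) x₂ (Sum.inr ρ) (Sum.inl κ₂) * ∑ y ∈ T, gaugeWt N y κ₂ x₂) (M ρ)) p p
      (((d : ℝ) + 1) * C * (Cs + CM) * Zl (d + 1) (δ / 2)
        * ∑ κ : Fin (d + 1),
          (∑ w' ∈ (T.biUnion (fun y => (box (d + 1) N).image (fun v => (N : ℤ) • y + toSite v))).image (fun v => v - unitVec κ)
                \ T.biUnion (fun y => (box (d + 1) N).image (fun v => (N : ℤ) • y + toSite v)), Real.exp (-δ * l1 (w' - q))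
            + ∑ w' ∈ T.biUnion (fun y => (box (d + 1) N).image (fun v => (N : ℤ) • y + toSite v))
                \ (T.biUnion (fun y => (box (d + 1) N).image (fun v => (N : ℤ) • y + toSite v))).image (fun v => v - unitVec κ),
                  Real.exp (-δ * l1 (w' - q)))) (δ / 2) :=
  biLoc_gaugeSup_sum_faceW_of_faceW hA hδ hN hS hM T le_rfl

/-! ## §3 The literal shape: the label-by-label sum of the single-label response pieces -/

/-- [folklore] **THE GAUGE-READ PIECE (γ) SUMMED OVER THE LABELS OF A SUPER-BLOCK IS A FACE LETTER AT THE SLOT (face-sum domination form).**  The label-by-label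
sum `Σ_{y∈T} 𝒢[A](ĝ_y)` — the left-hand side of leaf-06's `sum_gaugeSup`, i.e. the (γ) summand of `Ψ_j` in an1's literal `wsum ∕ cwsum` shape summed over the labels —
is `BiLoc` at `(p, p)`, rate `δ∕2`, constant `(d+1)·C·(Cs + CM)·Zl(δ∕2)·W` for any `W ≥ FW_U^δ(q)` (`sum_gaugeSup` ⨾ §2). -/
theorem biLoc_sum_gaugeSup_faceW_of_faceW [NeZero N] {A : MKer (d + 1) (Fib d)} {p q : Site (d + 1)} {C δ : ℝ} (hA : BiLoc A p q C δ) (hδ : 0 < δ)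
    (hN : 1 ≤ N) {S : Fin (d + 1) → Site (d + 1) → MKer (d + 1) (Fib d)} {Cs : ℝ} (hS : LocStencil S Cs δ)
    {M : Fin (d + 1) → Site (d + 1) → MKer (d + 1) (Fib d)} {CM : ℝ} (hM : VertexFamily M N CM δ) (T : Finset (Site (d + 1))) {W : ℝ}
    (hW : (∑ κ : Fin (d + 1),
          (∑ w' ∈ (T.biUnion (fun y => (box (d + 1) N).image (fun v => (N : ℤ) • y + toSite v))).image (fun v => v - unitVec κ)
                \ T.biUnion (fun y => (box (d + 1) N).image (fun v => (N : ℤ) • y + toSite v)), Real.exp (-δ * l1 (w' - q))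
            + ∑ w' ∈ T.biUnion (fun y => (box (d + 1) N).image (fun v => (N : ℤ) • y + toSite v))
                \ (T.biUnion (fun y => (box (d + 1) N).image (fun v => (N : ℤ) • y + toSite v))).image (fun v => v - unitVec κ),
                  Real.exp (-δ * l1 (w' - q)))) ≤ W) :
    BiLoc (∑ y ∈ T, (∑ κ, wsum (fun u => ∑' x₂, ∑ κ₂, A u x₂ (Sum.inl κ) (Sum.inl κ₂) * gaugeWt N y κ₂ x₂) (S κ)
        + ∑ ρ, cwsum N (fun w => ∑' x₂, ∑ κ₂, A ((N : ℤ) • w) x₂ (Sum.inr ρ) (Sum.inl κ₂) * gaugeWt N y κ₂ x₂) (M ρ))) p p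
      (((d : ℝ) + 1) * C * (Cs + CM) * Zl (d + 1) (δ / 2) * W) (δ / 2) := by
  rw [sum_gaugeSup hA hδ hN hS hM T]
  exact biLoc_gaugeSup_sum_faceW_of_faceW hA hδ hN hS hM T hW

/-- [folklore] **THE GAUGE-READ PIECE (γ) SUMMED OVER THE LABELS, FACE-SUM FORM** (`W := FW_U^δ(q)`): constant `(d+1)·C·(Cs + CM)·Zl(δ∕2)·FW_U^δ(q)`, rate `δ∕2` — supported
near the boundary layer of the fine union, UNIFORMLY IN `T` except through the face weight. -/
theorem biLoc_sum_gaugeSup_faceW [NeZero N] {A : MKer (d + 1) (Fib d)} {p q : Site (d + 1)} {C δ : ℝ} (hA : BiLoc A p q C δ) (hδ : 0 < δ)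
    (hN : 1 ≤ N) {S : Fin (d + 1) → Site (d + 1) → MKer (d + 1) (Fib d)} {Cs : ℝ} (hS : LocStencil S Cs δ)
    {M : Fin (d + 1) → Site (d + 1) → MKer (d + 1) (Fib d)} {CM : ℝ} (hM : VertexFamily M N CM δ) (T : Finset (Site (d + 1))) :
    BiLoc (∑ y ∈ T, (∑ κ, wsum (fun u => ∑' x₂, ∑ κ₂, A u x₂ (Sum.inl κ) (Sum.inl κ₂) * gaugeWt N y κ₂ x₂) (S κ)
        + ∑ ρ, cwsum N (fun w => ∑' x₂, ∑ κ₂, A ((N : ℤ) • w) x₂ (Sum.inr ρ) (Sum.inl κ₂) * gaugeWt N y κ₂ x₂) (M ρ))) p p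
      (((d : ℝ) + 1) * C * (Cs + CM) * Zl (d + 1) (δ / 2)
        * ∑ κ : Fin (d + 1),
          (∑ w' ∈ (T.biUnion (fun y => (box (d + 1) N).image (fun v => (N : ℤ) • y + toSite v))).image (fun v => v - unitVec κ)
                \ T.biUnion (fun y => (box (d + 1) N).image (fun v => (N : ℤ) • y + toSite v)), Real.exp (-δ * l1 (w' - q))
            + ∑ w' ∈ T.biUnion (fun y => (box (d + 1) N).image (fun v => (N : ℤ) • y + toSite v))
                \ (T.biUnion (fun y => (box (d + 1) N).image (fun v => (N : ℤ) • y + toSite v))).image (fun v => v - unitVec κ),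
                  Real.exp (-δ * l1 (w' - q)))) (δ / 2) :=
  biLoc_sum_gaugeSup_faceW_of_faceW hA hδ hN hS hM T le_rfl

end Summit.QuantumFields.BalabanUV.Beta.GAN24.LayerLetterGaugeRead

end
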